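import Mathlib
import HarnessLib
import Literature.Analysis.FluidPDE.LocalTypeIBlowup.CurlLimit
import Literature.Analysis.FluidPDE.LocalTypeIPersistenceHolds
import Literature.Analysis.FluidPDE.LocalTypeICongr
import Literature.Analysis.FluidPDE.TypeIRateOseenMildRepresentative
import Literature.Analysis.FluidPDE.TypeIAncientMild
import Literature.Analysis.FluidPDE.GigaMiura2011ScaledAlignmentBlowupLimitHolds

/-!
# Blow-up at a local Type I singular point, file 13: the zoom at a PRESCRIBED backward singular
# vertex with PRESCRIBED scales (Barker–Prange 2020, §4 Steps 2–3 with Lemma 3; Seregin–Šverák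
# 2009, Thm. 2.8; Albritton–Barker 2019, Prop. 2.3)

Analysis/FluidPDE proof file (theorems only: no definition, no named fact, no `sorry`), thirteenth
file of the Literature series `LocalTypeIBlowup/*` (blow-up procedure at a local Type I singular
point). Files `Approximants`–`CurlLimit` run the procedure with Caffarelli–Kohn–Nirenberg POINT
PICKING (the centres of the zooms are chosen by the `ε`-regularity threshold, the limit is
non-trivial by construction). Barker–Prange's geometric criteria on CONCENTRATING sets (T. Barker,
C. Prange, Arch. Ration. Mech. Anal. 235 (2020) = arXiv:1906.08225, Thm. 1 / Thm. 3; the tree's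
named fact `barkerPrange2020_alignment_concentrating_typeI`) need the other classical version of the
procedure, printed in their §4 (proof of Thm. 1, Step 2 "zoom in on the singularity": "Let
`R⁽ⁿ⁾ ↓ 0` and rescale `u⁽ⁿ⁾(y,s) := R⁽ⁿ⁾ u(R⁽ⁿ⁾y, T + (R⁽ⁿ⁾)² s)`", Step 3 "passage to the limit":
"Using the above a priori estimates and Lemma 3 [persistence of singularities] we obtain a limiting
suitable weak solution … such that `u^(∞)` has a singular point at `(x,t) = (0,0)`,
`sup_r {E + A + D} ≤ M'`, `sup √(−t)‖u^(∞)(·,t)‖_∞ ≤ M`"; p. 5: "The main flexibility of our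
method lies in the fact that we can use any sequence `R⁽ᵏ⁾ ↓ 0` in the rescaling procedure"):
the zoom is taken at the GIVEN singular vertex with a GIVEN sequence of scales, and the
non-triviality of the limit is replaced by the PERSISTENCE of the singularity (Barker–Prange's
Lemma 3 = Rusin–Šverák 2011, Lemma 2.1 / Albritton–Barker 2019, Prop. 2.3, the tree's PROVED
`PersistenceOfSingularities_holds`).

Contents (namespace `Literature.Analysis.FluidPDE.LocalTypeIBlowup`):

* `local_typeI_compactness_singular` — the tree's `local_typeI_compactness` (file `Engine`:
  compactness of Type-I-bounded suitable weak solutions given on the growing balls `Q(0, 2ᵐ)`,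
  `m ≤ k`, Albritton–Barker §3) re-run with ONE more conclusion, Step 5 of the tree's
  `slab_typeI_compactness`: if the approximants blow up in `L^∞(Q(0, R))` for every `R > 0` along
  the extracted subsequence, the origin is a backward singular point of the limit
  (`PersistenceOfSingularities_holds` on `Q(0, 1)`, which needs the weak convergence of the
  normalised pressures that `local_typeI_compactness` does not export — hence the re-run).
* `isTypeIAncientMild_of_continuous_oseenMild_rate` — packaging of a continuous, weakly
  divergence-free, Oseen-mild field with the Type-I rate as an element of the tree's class
  `IsTypeIAncientMild` (joint smoothness by KNSS Prop. 4.1 on every time-shifted copy,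
  `smooth_and_bounds_of_bounded_ancient_oseenMild`). (Literature twin of Summits-side one-liners
  such as `isTypeIAncientMild_of_continuous_oseenMild`; Literature may not import Summits.)
* `exists_typeIAncientMild_zoomLimit` — **the zoom at a prescribed backward singular vertex.**
  Let `(u, p)` be a suitable weak solution in `Q(z₀, ρ)` (Albritton–Barker's class Def. 2.1) with
  a weak gradient `G`, `𝐈(Q(z₀, ρ)) < ∞`, `u` continuous on `Q(z₀, ρ)` with the Type-I RATE
  `‖u(t,x)‖ ≤ M/√(t₀ − t)` there (`z₀ = (t₀, x₀)`), and `z₀` a backward singular point; let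
  `R_n > 0`, `R_n → 0` be ANY sequence of scales. Then along a subsequence `φ` the zooms
  `R u(t₀ + R² s, x₀ + R y)`, `R = R_{φ j}`, converge — pointwise on `s < −1`, together with their
  curls `R² curl u(t₀ + R² s)(x₀ + R y)` — to a field `U` of the class `IsTypeIAncientMild M U`
  (jointly smooth, divergence free, Oseen-mild between all pairs of negative times, rate `M`),
  which with some pressure `P` and gradient `H` is a suitable weak solution on the backward slab
  with `𝐈 < ∞` and HAS A BACKWARD SINGULAR POINT AT THE ORIGIN. Proof: the zoomed pairs are in the
  class on `Q(0, 2ᵐ)` with `𝐈 ≤ 𝐈(Q(z₀, ρ))` (scale covariance, files `SuitableWeakInBallTools`,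
  `LocalTypeIScaling`) and blow up on every `Q(0, R)` (`eLpNorm_top_nsZoom`);
  `local_typeI_compactness_singular` gives the `L³_loc` limit, singular at `0`; the rate passes to
  the limit a.e. (a.e.-convergent subsequences); `exists_rate_profile_repr` and
  `exists_oseenMild_repr_of_typeIBound_lt_top` (KNSS Lemma 3.1 with the parasitic drift killed by
  `𝐈`) give the continuous Oseen-mild representative; the `C¹_loc` convergence is file
  `CurlCompactness` (`exists_subseq_curl_limit`) applied to the zooms SHIFTED IN TIME BY `−1`, on
  which the rate is a uniform bound.

Nothing here is a claim about Navier–Stokes regularity; no new notion is introduced.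

## References

* T. Barker, C. Prange, Arch. Ration. Mech. Anal. 235 (2020) 881–926 = arXiv:1906.08225: §1
  Lemma 3 (p. 4), Prop. 4 (p. 5), §4 proof of Thm. 1 Steps 2–3 (pp. 16–17), §5 Thm. 3 (p. 18).
  [BarkerPrange2020Alignment]
* G. Seregin, V. Šverák, Comm. PDE 34 (2009) = arXiv:0804.1803, Thm. 2.8, §4 p. 11.
  [SereginSverak2009]
* D. Albritton, T. Barker, J. Math. Fluid Mech. 21 (2019) = arXiv:1811.00502, Lemma 2.2,
  Prop. 2.3, §3. [AlbrittonBarker2019]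
* W. Rusin, V. Šverák, J. Funct. Anal. 260 (2011), Lemma 2.1. [RusinSverak2011]
* G. Koch, N. Nadirashvili, G. Seregin, V. Šverák, Acta Math. 203 (2009) = arXiv:0709.3599,
  Lemma 3.1, §4 (i), Prop. 4.1, Lemma 6.1. [KochNadirashviliSereginSverak2009]
-/

noncomputable section

open MeasureTheory Set Function Filter Topology TopologicalSpace Metric
open scoped NNReal ENNReal
open Literature.Analysis Literature.Analysis.FluidPDE

namespace Literature.Analysis.FluidPDE.LocalTypeIBlowup

/-- `n + 1 ≤ 2 ^ (n + 1)` in `ℝ`. [folklore] -/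
private theorem nat_succ_le_two_pow' (n : ℕ) : ((n : ℝ) + 1) ≤ (2 : ℝ) ^ (n + 1) := by
  have h : n + 1 ≤ 2 ^ (n + 1) := (Nat.lt_two_pow_self (n := n + 1)).le
  exact_mod_cast h

/-! ### Compactness on growing balls, with persistence of the singularity -/

/-- **Compactness of Type-I-bounded suitable weak solutions given on growing balls, with
persistence of a singular origin** (Albritton–Barker 2019, §3 with Lemma 2.2 and Prop. 2.3;
Barker–Prange 2020, Lemma 3 and §4 Step 3). Let `(v_k, q_k)` be in Albritton–Barker's class
Def. 2.1 on `Q(0, 2ᵐ)` for all `m ≤ k`, with weak spatial gradients `G_k` there and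
`𝐈(Q(0, 2ᵐ); v_k, q_k, G_k) ≤ I < ∞`. Then along a subsequence `σ` the `v_{σ j}` converge in
`L³(Q(0, R))` for every `R > 0` to a suitable weak solution `(u, p)` on the backward slab with a
weak gradient `H` and `𝐈(u, p, H) ≤ 4 I`, `u ∈ L³(Q(0, R))` for every `R > 0`; and IF the
approximants blow up in `L^∞(Q(0, R))` for every `R > 0` along `σ`, the space–time origin is a
backward singular point of `u` (persistence of singularities on `Q(0, 1)`). This is the tree's
`local_typeI_compactness` (file `Engine`) with Step 5 of `slab_typeI_compactness` appended; the
proof is re-run because the persistence step consumes the weak convergence of the normalised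
pressures along the same subsequence. [cite: AlbrittonBarker2019, Lemma 2.2, Prop. 2.3 and §3; BarkerPrange2020Alignment, Lemma 3 and §4 Step 3 (arXiv:1906.08225 pp. 4, 17)] -/
theorem local_typeI_compactness_singular (I : ℝ≥0∞)
    (v : ℕ → ℝ → (EuclideanSpace ℝ (Fin 3)) → (EuclideanSpace ℝ (Fin 3)))
    (q : ℕ → ℝ → (EuclideanSpace ℝ (Fin 3)) → ℝ)
    (G : ℕ → ℝ → (EuclideanSpace ℝ (Fin 3)) → (EuclideanSpace ℝ (Fin 3)) →L[ℝ] (EuclideanSpace ℝ (Fin 3)))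
    (hI : I < ⊤)
    (hball : ∀ m k : ℕ, m ≤ k → IsSuitableWeakSolutionInBall ((2 : ℝ) ^ m) 0 (v k) (q k))
    (hwg : ∀ m k : ℕ, m ≤ k →
      HasWeakSpatialGradientOn (parabolicCylinderOpens ((2 : ℝ) ^ m) (0 : ℝ × (EuclideanSpace ℝ (Fin 3))))
        (v k) (G k))
    (hbd : ∀ m k : ℕ, m ≤ k →
      typeIBound (parabolicCylinder ((2 : ℝ) ^ m) (0 : ℝ × (EuclideanSpace ℝ (Fin 3)))) (v k) (q k) (G k) ≤ I) :
    ∃ (u : ℝ → (EuclideanSpace ℝ (Fin 3)) → (EuclideanSpace ℝ (Fin 3)))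
      (p : ℝ → (EuclideanSpace ℝ (Fin 3)) → ℝ)
      (H : ℝ → (EuclideanSpace ℝ (Fin 3)) → (EuclideanSpace ℝ (Fin 3)) →L[ℝ] (EuclideanSpace ℝ (Fin 3)))
      (σ : ℕ → ℕ),
      StrictMono σ ∧
      IsSuitableWeakSolutionOn (slab (EuclideanSpace ℝ (Fin 3)) (Iio 0) isOpen_Iio) 1 0 u p ∧
      HasWeakSpatialGradientOn (slab (EuclideanSpace ℝ (Fin 3)) (Iio 0) isOpen_Iio) u H ∧
      typeIBound (Iio (0 : ℝ) ×ˢ univ) u p H ≤ 4 * I ∧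
      (∀ R : ℝ, 0 < R → MemLp (uncurry u) 3
        (volume.restrict (parabolicCylinder R (0 : ℝ × (EuclideanSpace ℝ (Fin 3)))))) ∧
      (∀ R : ℝ, 0 < R → Tendsto (fun j => eLpNorm (uncurry (v (σ j)) - uncurry u) 3
        (volume.restrict (parabolicCylinder R (0 : ℝ × (EuclideanSpace ℝ (Fin 3)))))) atTop (𝓝 0)) ∧
      ((∀ R : ℝ, 0 < R → limsup (fun j => eLpNorm (uncurry (v (σ j))) ⊤
          (volume.restrict (parabolicCylinder R (0 : ℝ × (EuclideanSpace ℝ (Fin 3)))))) atTop = ⊤) →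
        IsBackwardSingularPoint u 0) := by
  have hItop : I ≠ ⊤ := hI.ne
  have hcc_pos : ∀ m : ℕ, (0 : ℝ) < (2 : ℝ) ^ m := fun m => by positivity
  have hcc_one : ∀ m : ℕ, (1 : ℝ) ≤ (2 : ℝ) ^ m := fun m => one_le_pow₀ (by norm_num)
  -- ## Step 0: normalise the pressures to unit-ball mean zero
  set qn : ℕ → ℝ → (EuclideanSpace ℝ (Fin 3)) → ℝ :=
    fun k t x => q k t x - ⨍ y in ball (0 : (EuclideanSpace ℝ (Fin 3))) 1, q k t y with hqn
  have hballn : ∀ m k : ℕ, m ≤ k → IsSuitableWeakSolutionInBall ((2 : ℝ) ^ m) 0 (v k) (qn k) :=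
    fun m k hmk => isSuitableWeakSolutionInBall_sub_unitBallMean (hcc_one m) (hball m k hmk)
  have hbdn : ∀ m k : ℕ, m ≤ k →
      typeIBound (parabolicCylinder ((2 : ℝ) ^ m) (0 : ℝ × (EuclideanSpace ℝ (Fin 3)))) (v k) (qn k) (G k) ≤ I := by
    intro m k hmk
    show typeIBound _ (v k) (fun t x => q k t x - ⨍ y in ball (0 : (EuclideanSpace ℝ (Fin 3))) 1, q k t y)
      (G k) ≤ I
    rw [typeIBound_sub_unitBallMean_ball (hball m k hmk).2.2.2]
    exact hbd m k hmk
  have h0 : ∀ k t, ⨍ y in ball (0 : (EuclideanSpace ℝ (Fin 3))) 1, qn k t y = 0 := fun k t =>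
    unitBallMean_normalised (q k) t
  -- ## Step 1: the uniform `L³ × L^{3/2}` bounds at every level
  have hbd2 : ∀ m : ℕ, (⨆ k, ⨆ (_ : m ≤ k), (eLpNorm (uncurry (v k)) 3
        (volume.restrict (parabolicCylinder ((2 : ℝ) ^ m) (0 : ℝ × (EuclideanSpace ℝ (Fin 3))))) +
      eLpNorm (uncurry (qn k)) (3 / 2)
        (volume.restrict (parabolicCylinder ((2 : ℝ) ^ m) (0 : ℝ × (EuclideanSpace ℝ (Fin 3))))))) < ∞ := by
    intro m
    set Cv : ℝ≥0∞ := (ENNReal.ofReal ((2 : ℝ) ^ m) ^ 2 * I) ^ (1 / 3 : ℝ) with hCv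
    set Cq : ℝ≥0∞ := (2 * (1 + volume (ball (0 : (EuclideanSpace ℝ (Fin 3))) ((2 : ℝ) ^ m)) *
        (volume (ball (0 : (EuclideanSpace ℝ (Fin 3))) 1))⁻¹) * (ENNReal.ofReal ((2 : ℝ) ^ m) ^ 2 * I)) ^
          (2 / 3 : ℝ) with hCq
    refine lt_of_le_of_lt (iSup₂_le fun k hmk => add_le_add ?_ ?_) (b := Cv + Cq) ?_
    · refine (eLpNorm_velocity_ball_le (hcc_pos m) Subset.rfl (qn k) (G k)).trans ?_
      exact ENNReal.rpow_le_rpow (mul_le_mul' le_rfl (hbdn m k hmk)) (by norm_num)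
    · refine (eLpNorm_pressure_ball_le (hcc_one m) (hballn m k hmk).2.2.2.1 (h0 k) Subset.rfl
        (v k) (G k)).trans ?_
      exact ENNReal.rpow_le_rpow (mul_le_mul' le_rfl (mul_le_mul' le_rfl (hbdn m k hmk))) (by norm_num)
    · refine ENNReal.add_lt_top.2 ⟨?_, ?_⟩
      · exact ENNReal.rpow_lt_top_of_nonneg (by norm_num)
          (ENNReal.mul_ne_top (ENNReal.pow_ne_top ENNReal.ofReal_ne_top) hItop)
      · refine ENNReal.rpow_lt_top_of_nonneg (by norm_num) ?_
        rw [← mul_assoc]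
        exact ENNReal.mul_ne_top (pressureConst_lt_top ((2 : ℝ) ^ m)).ne hItop
  -- ## Step 2: the limit along one subsequence
  obtain ⟨u, p, σ, hσ, hlim⟩ := local_suitableCompactness hballn hbd2
  -- ## Step 3: suitability on the slab and the weak gradient, by exhaustion
  have hswu : IsSuitableWeakSolutionOn (slab (EuclideanSpace ℝ (Fin 3)) (Iio 0) isOpen_Iio) 1 0 u p :=
    ESSBlowup.isSuitableWeakSolutionOn_halfspace fun a ha => (hlim a ha).1
  set Qn : ℕ → Opens (ℝ × (EuclideanSpace ℝ (Fin 3))) :=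
    fun n => parabolicCylinderOpens ((n : ℝ) + 1) (0 : ℝ × (EuclideanSpace ℝ (Fin 3))) with hQn
  have hmono : Monotone Qn := fun m n hmn z hz =>
    SuitableCompactness.parabolicCylinder_zero_mono (by positivity) (by simpa using hmn) hz
  have hcov : ∀ K ⊆ ((slab (EuclideanSpace ℝ (Fin 3)) (Iio 0) isOpen_Iio :
      Opens (ℝ × (EuclideanSpace ℝ (Fin 3)))) : Set (ℝ × (EuclideanSpace ℝ (Fin 3)))),
      IsCompact K → ∃ n, K ⊆ (Qn n : Set (ℝ × (EuclideanSpace ℝ (Fin 3)))) := fun K hK hKc =>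
    ESSBlowup.exists_subset_parabolicCylinder_of_isCompact hK hKc
  choose Gn hGn hGn2 using fun n : ℕ => (hlim ((n : ℝ) + 1) (by positivity)).1.2.2.1
  obtain ⟨H, hH, hHae⟩ := exists_hasWeakSpatialGradientOn_of_exhaustion
    (Q := slab (EuclideanSpace ℝ (Fin 3)) (Iio 0) isOpen_Iio) (Qn := Qn) hmono hcov hGn
  -- ## Step 4: `𝐈(u, p, H) ≤ 4 I` by lower semicontinuity of `A, C, D, E` on every admissible ball
  have h4I : typeIBound (Iio (0 : ℝ) ×ˢ univ) u p H ≤ 4 * I := by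
    refine typeIBound_le_iff.2 fun r hr z hz => ?_
    obtain ⟨n, hn⟩ : ∃ n : ℕ, parabolicCylinder r z ⊆
        parabolicCylinder ((n : ℝ) + 1) (0 : ℝ × (EuclideanSpace ℝ (Fin 3))) := by
      obtain ⟨n, hn⟩ := exists_nat_ge (max (r ^ 2 - z.1) (‖z.2‖ + r))
      refine ⟨n, fun w hw => ?_⟩
      have hw0 : w.1 < 0 := (hz hw).1
      rw [mem_parabolicCylinder] at hw
      rw [SuitableCompactness.mem_parabolicCylinder_zero]
      have h1 : r ^ 2 - z.1 ≤ n := (le_max_left _ _).trans hn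
      have h2 : ‖z.2‖ + r ≤ n := (le_max_right _ _).trans hn
      have h3 : (n : ℝ) ≤ ((n : ℝ) + 1) ^ 2 := by nlinarith [n.cast_nonneg (α := ℝ)]
      refine ⟨⟨by linarith [hw.1.1], hw0⟩, ?_⟩
      calc ‖w.2‖ = ‖(w.2 - z.2) + z.2‖ := by rw [sub_add_cancel]
        _ ≤ ‖w.2 - z.2‖ + ‖z.2‖ := norm_add_le _ _
        _ < r + ‖z.2‖ := by rw [← dist_eq_norm]; linarith [hw.2]
        _ ≤ (n : ℝ) + 1 := by linarith
    set a : ℝ := (n : ℝ) + 1 with ha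
    have ha0 : 0 < a := by positivity
    have ha1 : 1 ≤ a := by rw [ha]; linarith [n.cast_nonneg (α := ℝ)]
    set Q₀ : Set (ℝ × (EuclideanSpace ℝ (Fin 3))) :=
      parabolicCylinder a (0 : ℝ × (EuclideanSpace ℝ (Fin 3))) with hQ₀
    have hzQ : parabolicCylinder r z ⊆ Q₀ := hn
    obtain ⟨hballu, hum3, hconv, hweak⟩ := hlim a ha0
    have hleΩ : parabolicCylinderOpens r z ≤
        (slab (EuclideanSpace ℝ (Fin 3)) (Iio 0) isOpen_Iio : Opens (ℝ × (EuclideanSpace ℝ (Fin 3)))) :=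
      fun w hw => hz hw
    set m₀ : ℕ := n + 1 with hm₀
    have ham₀ : a ≤ (2 : ℝ) ^ m₀ := nat_succ_le_two_pow' n
    have hQ₀m : Q₀ ⊆ parabolicCylinder ((2 : ℝ) ^ m₀) (0 : ℝ × (EuclideanSpace ℝ (Fin 3))) :=
      parabolicCylinder_mono ha0.le ham₀ _
    have hzm : parabolicCylinder r z ⊆
        parabolicCylinder ((2 : ℝ) ^ m₀) (0 : ℝ × (EuclideanSpace ℝ (Fin 3))) := hzQ.trans hQ₀m
    have hleΩm : parabolicCylinderOpens r z ≤
        parabolicCylinderOpens ((2 : ℝ) ^ m₀) (0 : ℝ × (EuclideanSpace ℝ (Fin 3))) :=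
      fun w hw => hzm hw
    set σ' : ℕ → ℕ := fun j => σ (j + m₀) with hσ'
    have hσ'm : ∀ j, m₀ ≤ σ' j := fun j => (Nat.le_add_left m₀ j).trans (hσ.id_le (j + m₀))
    have hconv' : Tendsto (fun j => eLpNorm (uncurry (v (σ' j)) - uncurry u) 3
        (volume.restrict Q₀)) atTop (𝓝 0) := hconv.comp (tendsto_add_atTop_nat m₀)
    have hweak' : ∀ g : ℝ × (EuclideanSpace ℝ (Fin 3)) → ℝ, MemLp g 3 (volume.restrict Q₀) →
        Tendsto (fun j => ∫ w in Q₀, qn (σ' j) w.1 w.2 * g w) atTop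
          (𝓝 (∫ w in Q₀, p w.1 w.2 * g w)) := fun g hg =>
      (hweak g hg).comp (tendsto_add_atTop_nat m₀)
    have hbdσ : ∀ j, abScaledSum r z (v (σ' j)) (qn (σ' j)) (G (σ' j)) ≤ I := fun j =>
      (abScaledSum_le_typeIBound hr hzm).trans (hbdn m₀ (σ' j) (hσ'm j))
    have hvm : ∀ j, AEStronglyMeasurable (uncurry (v (σ' j))) (volume.restrict Q₀) := fun j =>
      (hballn m₀ (σ' j) (hσ'm j)).1.distributional.1.aestronglyMeasurable.mono_measure
        (Measure.restrict_mono hQ₀m le_rfl)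
    have hum : AEStronglyMeasurable (uncurry u) (volume.restrict Q₀) := hum3.1
    have hA : cknAEss r z u ≤ I :=
      cknAEss_le_of_tendsto_eLpNorm hr hzQ hvm hum hconv'
        fun j => cknAEss_le_abScaledSum.trans (hbdσ j)
    have hC : cknC r z u ≤ I :=
      cknC_le_of_tendsto_eLpNorm hr hzQ hvm hum hconv'
        fun j => cknC_le_abScaledSum.trans (hbdσ j)
    have hqmem : ∀ j, MemLp (uncurry (qn (σ' j))) (3 / 2) (volume.restrict Q₀) := fun j =>
      (hballn m₀ (σ' j) (hσ'm j)).2.2.2.mono_measure (Measure.restrict_mono hQ₀m le_rfl)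
    have hD : cknDOsc r z p ≤ I :=
      cknDOsc_le_of_tendsto_weakly hr hzQ hqmem hballu.2.2.2 hweak'
        fun j => cknDOsc_le_abScaledSum.trans (hbdσ j)
    have hHfin : ∫⁻ w in parabolicCylinder r z, ENNReal.ofReal (frobeniusNormSq (H w.1 w.2)) < ∞ := by
      have e : ∫⁻ w in parabolicCylinder r z, ENNReal.ofReal (frobeniusNormSq (H w.1 w.2)) =
          ∫⁻ w in parabolicCylinder r z, ENNReal.ofReal (frobeniusNormSq (Gn n w.1 w.2)) := by
        refine setLIntegral_congr_of_ae_imp (isOpen_parabolicCylinder r z).measurableSet hzQ ?_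
        filter_upwards [hHae n] with w hw hwS
        have e : H w.1 w.2 = Gn n w.1 w.2 := hw hwS
        rw [e]
      rw [e]
      exact lt_of_le_of_lt (lintegral_mono_set hzQ) (hGn2 n)
    have hE : cknE r z H ≤ I :=
      cknE_le_of_tendsto_eLpNorm hr hzQ (fun j => (hwg m₀ (σ' j) (hσ'm j)).mono hleΩm)
        (hH.mono hleΩ) hHfin hconv' fun j => cknE_le_abScaledSum.trans (hbdσ j)
    calc abScaledSum r z u p H = cknAEss r z u + cknC r z u + cknDOsc r z p + cknE r z H := rfl
      _ ≤ I + I + I + I := add_le_add (add_le_add (add_le_add hA hC) hD) hE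
      _ = 4 * I := by ring
  -- ## Step 5: persistence of singularities on `Q(0, 1)` (A–B Prop. 2.3 = B–P Lemma 3)
  have hpers : (∀ R : ℝ, 0 < R → limsup (fun j => eLpNorm (uncurry (v (σ j))) ⊤
      (volume.restrict (parabolicCylinder R (0 : ℝ × (EuclideanSpace ℝ (Fin 3)))))) atTop = ⊤) →
      IsBackwardSingularPoint u 0 := by
    intro hsup
    have hσge : ∀ j, j ≤ σ j := fun j => hσ.id_le j
    have hone : ∀ j, IsSuitableWeakSolutionInBall 1 0 (v (σ j)) (qn (σ j)) := fun j => by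
      have h := hballn 0 (σ j) (Nat.zero_le _)
      rwa [pow_zero] at h
    have hbd1 : (⨆ j, eLpNorm (uncurry (v (σ j))) 3
          (volume.restrict (parabolicCylinder 1 (0 : ℝ × (EuclideanSpace ℝ (Fin 3))))) +
        eLpNorm (uncurry (qn (σ j))) (3 / 2)
          (volume.restrict (parabolicCylinder 1 (0 : ℝ × (EuclideanSpace ℝ (Fin 3)))))) < ∞ := by
      have h := hbd2 0
      rw [pow_zero] at h
      refine lt_of_le_of_lt (iSup_le fun j => ?_) h
      refine le_trans ?_ (le_iSup₂ (f := fun k (_ : 0 ≤ k) => eLpNorm (uncurry (v k)) 3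
        (volume.restrict (parabolicCylinder 1 (0 : ℝ × (EuclideanSpace ℝ (Fin 3))))) +
        eLpNorm (uncurry (qn k)) (3 / 2)
        (volume.restrict (parabolicCylinder 1 (0 : ℝ × (EuclideanSpace ℝ (Fin 3)))))) (σ j) (Nat.zero_le _))
      exact le_rfl
    refine PersistenceOfSingularities_holds (fun j => v (σ j)) (fun j => qn (σ j)) u p hone hbd1
      (fun R hR => ?_) (fun R hR => hsup R hR.1)
    obtain ⟨h1, -, h3, h4⟩ := hlim R hR.1
    exact ⟨h1, h3, h4⟩
  exact ⟨u, p, H, σ, hσ, hswu, hH, h4I, fun R hR => (hlim R hR).2.1, fun R hR => (hlim R hR).2.2.1,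
    hpers⟩

/-! ### Packaging a continuous Oseen-mild field with the Type-I rate -/

/-- **A continuous, weakly divergence-free, Oseen-mild field on the backward slab with the
Type-I rate is a Type I ancient mild field** in the sense of the tree's class `IsTypeIAncientMild`
(KNSS 2009, §4 (i) p. 8, Prop. 4.1: bounded mild solutions are smooth — applied to every
time-shifted copy `t ↦ U(t − δ)`, which is bounded by `M/√δ`, via the tree's
`smooth_and_bounds_of_bounded_ancient_oseenMild`; pointwise `div = 0` from the weak form on `C¹`
slices). [cite: KochNadirashviliSereginSverak2009, §4 (i) p. 8 and Prop. 4.1 (arXiv:0709.3599)] -/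
theorem isTypeIAncientMild_of_continuous_oseenMild_rate {M : ℝ}
    {U : ℝ → (EuclideanSpace ℝ (Fin 3)) → (EuclideanSpace ℝ (Fin 3))}
    (hc : ContinuousOn (uncurry U) (Iio 0 ×ˢ univ))
    (hdiv : ∀ t < 0, IsWeaklyDivFree (U t))
    (hmild : ∀ s t : ℝ, s < t → t < 0 → ∀ x,
      U t x = UnboundedOperators.heatExtension (U s) (t - s) x - oseenDuhamel 1 s U U t x)
    (hrate : HasTypeITimeDecay M U) : IsTypeIAncientMild M U := by
  have hM : 0 ≤ M := by
    have h := hrate (-1) (by norm_num) 0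
    rw [neg_neg, Real.sqrt_one, div_one] at h
    exact (norm_nonneg _).trans h
  -- ## joint smoothness, locally in time, from the time-shifted bounded copies
  have hsm : ContDiffOn ℝ (⊤ : ℕ∞) (uncurry U) (Iio 0 ×ˢ univ) := by
    refine contDiffOn_of_locally_contDiffOn fun z hz => ?_
    obtain ⟨hz1, -⟩ := hz
    rw [mem_Iio] at hz1
    set δ : ℝ := -z.1 / 2 with hδdef
    have hδ : 0 < δ := by rw [hδdef]; linarith
    set W : ℝ → (EuclideanSpace ℝ (Fin 3)) → (EuclideanSpace ℝ (Fin 3)) := fun t => U (t - δ) with hW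
    have hWc : ContinuousOn (uncurry W) (Iio 0 ×ˢ univ) := by
      have e : uncurry W = uncurry U ∘ fun q : ℝ × (EuclideanSpace ℝ (Fin 3)) => (q.1 - δ, q.2) := rfl
      rw [e]
      refine hc.comp ((continuous_fst.sub continuous_const).prodMk continuous_snd).continuousOn ?_
      intro q hq
      rw [mem_prod, mem_Iio] at hq ⊢
      exact ⟨by linarith [hq.1], mem_univ _⟩
    have hWdiv : ∀ t < 0, IsWeaklyDivFree (W t) := fun t ht => hdiv (t - δ) (by linarith)
    have hWmild : ∀ s t : ℝ, s < t → t < 0 → ∀ x,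
        W t x = UnboundedOperators.heatExtension (W s) (t - s) x - oseenDuhamel 1 s W W t x := by
      intro s t hst ht x
      have key := hmild (s - δ) (t - δ) (by linarith) (by linarith) x
      rw [hW, oseenDuhamel_comp_sub_right, sub_sub_sub_cancel_right] at *
      exact key
    have hWbd : ∀ t < 0, ∀ x, ‖W t x‖ ≤ M / Real.sqrt δ := by
      intro t ht x
      refine (hrate (t - δ) (by linarith) x).trans ?_
      exact div_le_div_of_nonneg_left hM (Real.sqrt_pos.2 hδ) (Real.sqrt_le_sqrt (by linarith))
    obtain ⟨hWsm, -⟩ := smooth_and_bounds_of_bounded_ancient_oseenMild hWc hWdiv hWmild hWbd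
    refine ⟨Iio (-δ) ×ˢ univ, isOpen_Iio.prod isOpen_univ, ⟨?_, mem_univ _⟩, ?_⟩
    · rw [mem_Iio, hδdef]; linarith
    · have e : uncurry U = uncurry W ∘ fun q : ℝ × (EuclideanSpace ℝ (Fin 3)) => (q.1 + δ, q.2) := by
        funext q
        simp only [hW, comp_apply, uncurry, add_sub_cancel_right]
      rw [e]
      refine hWsm.comp ((contDiff_fst.add contDiff_const).prodMk contDiff_snd).contDiffOn ?_
      rintro q ⟨-, hq⟩
      rw [mem_prod, mem_Iio] at hq ⊢
      exact ⟨by linarith [hq.1], mem_univ _⟩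
  refine ⟨hsm, fun t ht => ?_, fun s t hst ht x => ?_, hrate⟩
  · exact (hdiv t ht).isDivFree_of_contDiff
      ((contDiff_slice_of_contDiffOn hsm (mem_Iio.2 ht)).of_le (by exact_mod_cast le_top))
  · rw [heatFlow_of_pos _ (sub_pos.2 hst)]
    exact hmild s t hst ht x

/-! ### The zoom at a prescribed backward singular vertex -/

/-- Strong `L³` convergence on a set has an a.e. convergent subsequence. [folklore] -/
private theorem exists_subseq_tendsto_ae' {Q₀ : Set (ℝ × (EuclideanSpace ℝ (Fin 3)))}
    {v : ℕ → ℝ → (EuclideanSpace ℝ (Fin 3)) → (EuclideanSpace ℝ (Fin 3))}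
    {U : ℝ → (EuclideanSpace ℝ (Fin 3)) → (EuclideanSpace ℝ (Fin 3))}
    (hv : ∀ k, AEStronglyMeasurable (uncurry (v k)) (volume.restrict Q₀))
    (hU : AEStronglyMeasurable (uncurry U) (volume.restrict Q₀))
    (hconv : Tendsto (fun k => eLpNorm (uncurry (v k) - uncurry U) 3 (volume.restrict Q₀))
      atTop (𝓝 0)) :
    ∃ φ : ℕ → ℕ, StrictMono φ ∧ ∀ᵐ w ∂(volume.restrict Q₀),
      Tendsto (fun i => uncurry (v (φ i)) w) atTop (𝓝 (uncurry U w)) :=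
  (tendstoInMeasure_of_tendsto_eLpNorm (by norm_num) hv hU hconv).exists_seq_tendsto_ae

/-- Every point of the open backward slab lies in some `Q(0, 2ᵐ)`. [folklore] -/
private theorem exists_mem_parabolicCylinder_two_pow {t : ℝ} (ht : t < 0) (x : EuclideanSpace ℝ (Fin 3)) :
    ∃ m : ℕ, ((t, x) : ℝ × (EuclideanSpace ℝ (Fin 3))) ∈
      parabolicCylinder ((2 : ℝ) ^ m) (0 : ℝ × (EuclideanSpace ℝ (Fin 3))) := by
  obtain ⟨m, hm⟩ := pow_unbounded_of_one_lt (max (-t) ‖x‖ + 1) (by norm_num : (1 : ℝ) < 2)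
  refine ⟨m, ?_⟩
  have h1 : (1 : ℝ) ≤ (2 : ℝ) ^ m := one_le_pow₀ (by norm_num)
  have h2 : -t < (2 : ℝ) ^ m := by linarith [le_max_left (-t) ‖x‖]
  have h3 : ‖x‖ < (2 : ℝ) ^ m := by linarith [le_max_right (-t) ‖x‖]
  rw [mem_parabolicCylinder]
  simp only [Prod.fst_zero, Prod.snd_zero, zero_sub, dist_zero_right]
  refine ⟨⟨?_, ht⟩, h3⟩
  nlinarith

/-- **The zoom at a prescribed backward singular vertex with prescribed scales** (Barker–Prange
2020, §4 proof of Thm. 1, Step 2 "zoom in on the singularity: let `R⁽ⁿ⁾ ↓ 0` and rescale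
`u⁽ⁿ⁾(y,s) := R⁽ⁿ⁾ u(R⁽ⁿ⁾y, T + (R⁽ⁿ⁾)² s)`" and Step 3 "passage to the limit: using the a priori
estimates and Lemma 3 we obtain a limiting suitable weak solution … `u^(∞)` has a singular point at
`(0,0)` … `sup √(−t)‖u^(∞)(·,t)‖_∞ ≤ M` … a mild solution on `(−∞, 0)`", with Seregin–Šverák 2009,
Thm. 2.8 / §4 p. 11 for the convergence "uniformly on compact sets together with the
derivatives"). Let `(u, p)` be a suitable weak solution in the parabolic ball `Q(z₀, ρ)`,
`z₀ = (t₀, x₀)` (Albritton–Barker's class Def. 2.1), with a weak gradient `G` and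
`𝐈(Q(z₀, ρ)) < ∞`, `u` continuous on `Q(z₀, ρ)` and obeying there the Type-I RATE
`‖u(t,x)‖ ≤ M/√(t₀ − t)`, and let `z₀` be a backward singular point of `u`. Let `R n > 0`,
`R n → 0` be any sequence of scales. Then there are a subsequence `φ` and a field `U` of the class
`IsTypeIAncientMild M U` which, with a pressure `P` and a weak gradient `H`, is a suitable weak
solution on the backward slab `(−∞, 0) × ℝ³` with `𝐈 < ∞` and a **backward singular point at the
origin**, such that for every `s < −1` and every `y` the zooms `R u(t₀ + R² s, x₀ + R y)`,
`R = R (φ j)`, converge to `U(s, y)` and their curls `R² curl u(t₀ + R² s)(x₀ + R y)` to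
`curl U(s)(y)`. (The convergence in fact holds for all `s < 0` along suitable subsequences; the
window `s < −1`, obtained from one time shift, is what the consumers use.)
[cite: BarkerPrange2020Alignment, §4 proof of Thm. 1 Steps 2–3 and Lemma 3 (arXiv:1906.08225 pp. 4, 16–17); SereginSverak2009, Thm 2.8 and §4 p. 11; AlbrittonBarker2019, Prop. 2.3 and §3] -/
theorem exists_typeIAncientMild_zoomLimit
    {u : ℝ → (EuclideanSpace ℝ (Fin 3)) → (EuclideanSpace ℝ (Fin 3))}
    {p : ℝ → (EuclideanSpace ℝ (Fin 3)) → ℝ}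
    {G : ℝ → (EuclideanSpace ℝ (Fin 3)) → (EuclideanSpace ℝ (Fin 3)) →L[ℝ] (EuclideanSpace ℝ (Fin 3))}
    {z₀ : ℝ × (EuclideanSpace ℝ (Fin 3))} {ρ M : ℝ} (hρ : 0 < ρ)
    (hball : IsSuitableWeakSolutionInBall ρ z₀ u p)
    (hwg : HasWeakSpatialGradientOn (parabolicCylinderOpens ρ z₀) u G)
    (hI : typeIBound (parabolicCylinder ρ z₀) u p G < ⊤)
    (hcont : ContinuousOn (uncurry u) (parabolicCylinder ρ z₀))
    (hrate : ∀ (t : ℝ) (x : EuclideanSpace ℝ (Fin 3)), (t, x) ∈ parabolicCylinder ρ z₀ →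
      ‖u t x‖ ≤ M / Real.sqrt (z₀.1 - t))
    (hsing : IsBackwardSingularPoint u z₀)
    {R : ℕ → ℝ} (hR : ∀ n, 0 < R n) (hR0 : Tendsto R atTop (𝓝 0)) :
    ∃ φ : ℕ → ℕ, StrictMono φ ∧
      ∃ (U : ℝ → (EuclideanSpace ℝ (Fin 3)) → (EuclideanSpace ℝ (Fin 3)))
        (P : ℝ → (EuclideanSpace ℝ (Fin 3)) → ℝ)
        (H : ℝ → (EuclideanSpace ℝ (Fin 3)) → (EuclideanSpace ℝ (Fin 3)) →L[ℝ] (EuclideanSpace ℝ (Fin 3))),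
        IsTypeIAncientMild M U ∧
        IsSuitableWeakSolutionOn (slab (EuclideanSpace ℝ (Fin 3)) (Iio 0) isOpen_Iio) 1 0 U P ∧
        HasWeakSpatialGradientOn (slab (EuclideanSpace ℝ (Fin 3)) (Iio 0) isOpen_Iio) U H ∧
        typeIBound (Iio (0 : ℝ) ×ˢ univ) U P H < ⊤ ∧
        IsBackwardSingularPoint U 0 ∧
        (∀ s < (-1 : ℝ), ∀ y : EuclideanSpace ℝ (Fin 3),
          Tendsto (fun j => R (φ j) • u (z₀.1 + R (φ j) ^ 2 * s) (z₀.2 + R (φ j) • y)) atTop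
            (𝓝 (U s y))) ∧
        (∀ s < (-1 : ℝ), ∀ y : EuclideanSpace ℝ (Fin 3),
          Tendsto (fun j => R (φ j) ^ 2 • curl (u (z₀.1 + R (φ j) ^ 2 * s)) (z₀.2 + R (φ j) • y))
            atTop (𝓝 (curl (U s) y))) := by
  -- ## constants
  have hρ2 : 0 < ρ ^ 2 := pow_pos hρ 2
  have hM : 0 ≤ M := by
    have hmem : ((z₀.1 - ρ ^ 2 / 2, z₀.2) : ℝ × (EuclideanSpace ℝ (Fin 3))) ∈ parabolicCylinder ρ z₀ := by
      rw [mem_parabolicCylinder]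
      exact ⟨⟨by linarith, by linarith⟩, by simp [hρ]⟩
    have h := hrate _ _ hmem
    have hs : 0 < Real.sqrt (z₀.1 - (z₀.1 - ρ ^ 2 / 2)) := Real.sqrt_pos.2 (by linarith)
    by_contra hM
    push Not at hM
    linarith [norm_nonneg (u (z₀.1 - ρ ^ 2 / 2) z₀.2), div_neg_of_neg_of_pos hM hs]
  have hcc_pos : ∀ m : ℕ, (0 : ℝ) < (2 : ℝ) ^ m := fun m => by positivity
  set I : ℝ≥0∞ := typeIBound (parabolicCylinder ρ z₀) u p G with hIdef
  -- ## Step 1: fast scales `lam k = R (φ₀ k) ≤ ρ / 2^(k+2)`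
  have hev : ∀ k : ℕ, ∀ᶠ n in atTop, R n ≤ ρ / (2 : ℝ) ^ (k + 2) := fun k =>
    (hR0.eventually (Iic_mem_nhds (by positivity : (0 : ℝ) < ρ / (2 : ℝ) ^ (k + 2)))).mono
      fun n hn => hn
  obtain ⟨φ₀, hφ₀, hφ₀R⟩ := extraction_forall_of_eventually hev
  set lam : ℕ → ℝ := fun k => R (φ₀ k) with hlam
  have hlam0 : ∀ k, 0 < lam k := fun k => hR (φ₀ k)
  have hbig : ∀ k, (2 : ℝ) ^ (k + 2) ≤ ρ / lam k := fun k => by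
    rw [le_div_iff₀ (hlam0 k)]
    have h := hφ₀R k
    rw [le_div_iff₀ (hcc_pos (k + 2))] at h
    simpa only [hlam, mul_comm] using h
  -- ## Step 2: the zoomed pairs and their properties
  set v : ℕ → ℝ → (EuclideanSpace ℝ (Fin 3)) → (EuclideanSpace ℝ (Fin 3)) :=
    fun k => lam k • stPull (lam k ^ 2) (lam k) z₀.1 z₀.2 u with hv
  set qz : ℕ → ℝ → (EuclideanSpace ℝ (Fin 3)) → ℝ :=
    fun k => lam k ^ 2 • stPull (lam k ^ 2) (lam k) z₀.1 z₀.2 p with hqz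
  set Gz : ℕ → ℝ → (EuclideanSpace ℝ (Fin 3)) → (EuclideanSpace ℝ (Fin 3)) →L[ℝ] (EuclideanSpace ℝ (Fin 3)) :=
    fun k => lam k ^ 2 • stPull (lam k ^ 2) (lam k) z₀.1 z₀.2 G with hGz
  -- the class on `Q(0, ρ / lam k)`
  have hInbig : ∀ k, IsSuitableWeakSolutionInBall (ρ / lam k) 0 (v k) (qz k) := by
    intro k
    have h1 := hball.zoom hρ
    set c : ℝ := lam k / ρ with hc
    have hc0 : 0 < c := div_pos (hlam0 k) hρ
    have h2 := h1.zoomOut hc0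
    have hcρ : c * ρ = lam k := div_mul_cancel₀ _ hρ.ne'
    have hrad : 1 / c = ρ / lam k := by rw [hc, one_div_div]
    rw [zoom_zoom, zoom_zoom, hcρ, hrad, show c ^ 2 * ρ ^ 2 = lam k ^ 2 by rw [← hcρ]; ring] at h2
    exact h2
  have hsub : ∀ m k : ℕ, m ≤ k + 2 →
      parabolicCylinder ((2 : ℝ) ^ m) (0 : ℝ × (EuclideanSpace ℝ (Fin 3))) ⊆
        parabolicCylinder (ρ / lam k) (0 : ℝ × (EuclideanSpace ℝ (Fin 3))) := fun m k hmk =>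
    parabolicCylinder_mono (hcc_pos m).le ((pow_le_pow_right₀ (by norm_num) hmk).trans (hbig k)) _
  have hballs : ∀ m k : ℕ, m ≤ k + 2 →
      IsSuitableWeakSolutionInBall ((2 : ℝ) ^ m) 0 (v k) (qz k) := fun m k hmk =>
    (hInbig k).of_subset_zero (hcc_pos m) (hsub m k hmk)
  -- the weak gradients
  have hpre : ∀ k, stPreimage (lam k ^ 2) (lam k) z₀.1 z₀.2 (parabolicCylinderOpens ρ z₀) =
      parabolicCylinderOpens (ρ / lam k) (0 : ℝ × (EuclideanSpace ℝ (Fin 3))) := fun k =>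
    Opens.ext (zoom_preimage_parabolicCylinder (hlam0 k) z₀ ρ)
  have hgrads : ∀ m k : ℕ, m ≤ k + 2 →
      HasWeakSpatialGradientOn (parabolicCylinderOpens ((2 : ℝ) ^ m) (0 : ℝ × (EuclideanSpace ℝ (Fin 3))))
        (v k) (Gz k) := by
    intro m k hmk
    have h1 := hwg.stRescale (lam k) (β := lam k ^ 2) (γ := lam k) (pow_pos (hlam0 k) 2) (hlam0 k)
      z₀.1 z₀.2
    rw [show lam k * lam k = lam k ^ 2 by ring, hpre k] at h1
    exact h1.mono (fun w hw => hsub m k hmk hw)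
  -- the Type I bound
  have hIs : ∀ m k : ℕ, m ≤ k + 2 →
      typeIBound (parabolicCylinder ((2 : ℝ) ^ m) (0 : ℝ × (EuclideanSpace ℝ (Fin 3)))) (v k) (qz k) (Gz k) ≤ I := by
    intro m k hmk
    rw [hIdef, ← typeIBound_nsZoom (hlam0 k) z₀.1 z₀.2 (parabolicCylinder ρ z₀) u p G,
      zoom_preimage_parabolicCylinder (hlam0 k) z₀ ρ]
    exact typeIBound_mono (hsub m k hmk)
  -- blow-up on every `Q(0, r)`: the vertex `z₀` is singular
  have hst0 : ∀ k, stAffine (lam k ^ 2) (lam k) z₀.1 z₀.2 (0 : ℝ × (EuclideanSpace ℝ (Fin 3))) = z₀ := by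
    intro k
    rw [show (0 : ℝ × (EuclideanSpace ℝ (Fin 3))) = ((0 : ℝ), (0 : EuclideanSpace ℝ (Fin 3))) from rfl,
      stAffine_apply, mul_zero, add_zero, smul_zero, add_zero]
  have hblow : ∀ k (r : ℝ), 0 < r →
      eLpNorm (uncurry (v k)) ⊤ (volume.restrict (parabolicCylinder r (0 : ℝ × (EuclideanSpace ℝ (Fin 3))))) = ⊤ := by
    intro k r hr
    show eLpNorm (uncurry (lam k • stPull (lam k ^ 2) (lam k) z₀.1 z₀.2 u)) ⊤ _ = ⊤
    rw [eLpNorm_top_nsZoom (hlam0 k) z₀.1 z₀.2 r 0 u, hst0, hsing (lam k * r) (mul_pos (hlam0 k) hr),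
      ENNReal.mul_top (ENNReal.ofReal_pos.2 (hlam0 k)).ne']
  -- the rate on `Q(0, ρ / lam k)`
  have hratev : ∀ k, ∀ w ∈ parabolicCylinder (ρ / lam k) (0 : ℝ × (EuclideanSpace ℝ (Fin 3))),
      ‖v k w.1 w.2‖ ≤ M / Real.sqrt (-w.1) := by
    rintro k ⟨s, y⟩ hw
    have hmem := zoom_mem_parabolicCylinder (hlam0 k) z₀ hw
    rw [stAffine_apply] at hmem
    have hs0 : s < 0 := by
      rw [mem_parabolicCylinder] at hw
      simpa using hw.1.2
    have h := hrate _ _ hmem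
    have hsq : Real.sqrt (z₀.1 - (z₀.1 + lam k ^ 2 * s)) = lam k * Real.sqrt (-s) := by
      rw [show z₀.1 - (z₀.1 + lam k ^ 2 * s) = lam k ^ 2 * (-s) by ring, Real.sqrt_mul (sq_nonneg _),
        Real.sqrt_sq (hlam0 k).le]
    rw [hsq] at h
    have hspos : 0 < Real.sqrt (-s) := Real.sqrt_pos.2 (by linarith)
    show ‖(lam k • stPull (lam k ^ 2) (lam k) z₀.1 z₀.2 u) s y‖ ≤ M / Real.sqrt (-s)
    rw [smul_stPull_apply, norm_smul, Real.norm_of_nonneg (hlam0 k).le, le_div_iff₀ hspos]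
    have h' := (le_div_iff₀ (mul_pos (hlam0 k) hspos)).1 h
    calc lam k * ‖u (z₀.1 + lam k ^ 2 * s) (z₀.2 + lam k • y)‖ * Real.sqrt (-s)
        = ‖u (z₀.1 + lam k ^ 2 * s) (z₀.2 + lam k • y)‖ * (lam k * Real.sqrt (-s)) := by ring
      _ ≤ M := h'
  -- continuity of the zooms on `Q(0, ρ / lam k)`
  have hvc : ∀ k, ContinuousOn (uncurry (v k))
      (parabolicCylinder (ρ / lam k) (0 : ℝ × (EuclideanSpace ℝ (Fin 3)))) := by
    intro k
    have e : uncurry (v k) = fun w => lam k • (uncurry u ∘ stAffine (lam k ^ 2) (lam k) z₀.1 z₀.2) w := by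
      funext w
      rfl
    rw [e]
    refine ContinuousOn.const_smul (hcont.comp (continuous_stAffine _ _ _ _).continuousOn ?_) (lam k)
    exact fun w hw => zoom_mem_parabolicCylinder (hlam0 k) z₀ hw
  -- ## Step 3: compactness with persistence of the singularity
  obtain ⟨Ut, Pt, Ht, σ, hσ, hswU, hHU, h4I, hmemU, hconvU, hpers⟩ :=
    local_typeI_compactness_singular I v qz Gz hI (fun m k hmk => hballs m k (by omega))
      (fun m k hmk => hgrads m k (by omega)) (fun m k hmk => hIs m k (by omega))
  have hσge : ∀ j, j ≤ σ j := fun j => hσ.id_le j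
  have hsingU : IsBackwardSingularPoint Ut 0 := hpers fun r hr => by
    simp only [hblow _ r hr]
    exact limsup_const ⊤
  have h4Itop : typeIBound (Iio (0 : ℝ) ×ˢ univ) Ut Pt Ht < ⊤ :=
    lt_of_le_of_lt h4I (ENNReal.mul_lt_top (by simp) hI)
  -- ## Step 4: the rate, almost everywhere on the slab
  have hrate_ae : ∀ᵐ w ∂(volume.restrict (Iio (0 : ℝ) ×ˢ (univ : Set (EuclideanSpace ℝ (Fin 3))))),
      ‖Ut w.1 w.2‖ ≤ M / Real.sqrt (-w.1) := by
    have hQ : ∀ m : ℕ, ∀ᵐ w ∂(volume.restrict (parabolicCylinder ((2 : ℝ) ^ m) (0 : ℝ × (EuclideanSpace ℝ (Fin 3))))),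
        ‖Ut w.1 w.2‖ ≤ M / Real.sqrt (-w.1) := by
      intro m
      have hmeas : ∀ j, AEStronglyMeasurable (uncurry (v (σ (j + m))))
          (volume.restrict (parabolicCylinder ((2 : ℝ) ^ m) (0 : ℝ × (EuclideanSpace ℝ (Fin 3))))) := fun j =>
        (hballs m (σ (j + m)) (by linarith [hσge (j + m)])).1.distributional.1.aestronglyMeasurable
      obtain ⟨ψ₁, hψ₁, hae⟩ := exists_subseq_tendsto_ae' hmeas (hmemU _ (hcc_pos m)).1
        ((hconvU _ (hcc_pos m)).comp (tendsto_add_atTop_nat m))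
      filter_upwards [hae, ae_restrict_mem (isOpen_parabolicCylinder _ _).measurableSet] with w hw hwmem
      refine le_of_tendsto hw.norm (Eventually.of_forall fun i => ?_)
      have hle : m ≤ σ (ψ₁ i + m) + 2 := by linarith [hσge (ψ₁ i + m)]
      exact hratev _ w (hsub m _ hle hwmem)
    have hcover : (Iio (0 : ℝ) ×ˢ (univ : Set (EuclideanSpace ℝ (Fin 3)))) ⊆
        ⋃ m : ℕ, parabolicCylinder ((2 : ℝ) ^ m) (0 : ℝ × (EuclideanSpace ℝ (Fin 3))) := by
      rintro ⟨t, x⟩ ⟨ht, -⟩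
      obtain ⟨m, hm⟩ := exists_mem_parabolicCylinder_two_pow (mem_Iio.1 ht) x
      exact mem_iUnion.2 ⟨m, hm⟩
    exact ae_restrict_of_ae_restrict_of_subset hcover ((ae_restrict_iUnion_iff _ _).2 hQ)
  -- ## Step 5: the representatives (rate everywhere; continuous Oseen-mild)
  obtain ⟨U₁, hae₁, hsw₁, hwg₁, hI₁, hdec₁, hsing₁⟩ :=
    exists_rate_profile_repr hM hswU hHU h4Itop hsingU hrate_ae
  obtain ⟨U, hae₂, hUc, hUdiv, hUmild, hUrate⟩ := exists_oseenMild_repr_of_typeIBound_lt_top hsw₁ hdec₁ hI₁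
  have hae₂' : ∀ᵐ w ∂(volume.restrict ((slab (EuclideanSpace ℝ (Fin 3)) (Iio 0) isOpen_Iio :
      Opens (ℝ × (EuclideanSpace ℝ (Fin 3)))) : Set (ℝ × (EuclideanSpace ℝ (Fin 3))))),
      uncurry U₁ w = uncurry U w := by
    rw [coe_slab]
    exact hae₂
  have hswU' : IsSuitableWeakSolutionOn (slab (EuclideanSpace ℝ (Fin 3)) (Iio 0) isOpen_Iio) 1 0 U Pt :=
    hsw₁.congr_ae hae₂' (ae_of_all _ fun _ => rfl)
  have hwgU' : HasWeakSpatialGradientOn (slab (EuclideanSpace ℝ (Fin 3)) (Iio 0) isOpen_Iio) U Ht :=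
    hwg₁.congr_ae hae₂'
  have hIU' : typeIBound (Iio (0 : ℝ) ×ˢ univ) U Pt Ht < ⊤ := by
    rwa [← typeIBound_congr_ae hae₂]
  have hsingU' : IsBackwardSingularPoint U 0 :=
    hsing₁.congr_ae (fun r _ => parabolicCylinder_origin_subset_slab r) hae₂
  have hTI : IsTypeIAncientMild M U := isTypeIAncientMild_of_continuous_oseenMild_rate hUc hUdiv hUmild hUrate
  have haeU : ∀ᵐ w ∂(volume.restrict (Iio (0 : ℝ) ×ˢ (univ : Set (EuclideanSpace ℝ (Fin 3))))),
      uncurry Ut w = uncurry U w := by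
    filter_upwards [hae₁, hae₂] with w h1 h2
    rw [h1, h2]
  -- ## Step 6: the zooms shifted in time by `-1` and their `C¹_loc` convergence
  set w : ℕ → ℝ → (EuclideanSpace ℝ (Fin 3)) → (EuclideanSpace ℝ (Fin 3)) :=
    fun k => (1 : ℝ) • stPull ((1 : ℝ) ^ 2) 1 (-1) 0 (v (σ k)) with hwdef
  set qw : ℕ → ℝ → (EuclideanSpace ℝ (Fin 3)) → ℝ :=
    fun k => (1 : ℝ) ^ 2 • stPull ((1 : ℝ) ^ 2) 1 (-1) 0 (qz (σ k)) with hqw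
  set Gw : ℕ → ℝ → (EuclideanSpace ℝ (Fin 3)) → (EuclideanSpace ℝ (Fin 3)) →L[ℝ] (EuclideanSpace ℝ (Fin 3)) :=
    fun k => (1 : ℝ) ^ 2 • stPull ((1 : ℝ) ^ 2) 1 (-1) 0 (Gz (σ k)) with hGw
  have hw_apply : ∀ k s y, w k s y = v (σ k) (s - 1) y := fun k s y => by
    show ((1 : ℝ) • stPull ((1 : ℝ) ^ 2) 1 (-1) 0 (v (σ k))) s y = _
    rw [smul_stPull_apply, one_smul, one_pow, one_mul, one_smul, zero_add, neg_add_eq_sub]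
  -- the shifted points stay in the domain: `(s - 1, y) ∈ Q(0, ρ/lam (σ k))` for `(s, y) ∈ Q(0, 2^(k+1))`
  have hshift_mem : ∀ k, ∀ z ∈ parabolicCylinder ((2 : ℝ) ^ (k + 1)) (0 : ℝ × (EuclideanSpace ℝ (Fin 3))),
      ((z.1 - 1, z.2) : ℝ × (EuclideanSpace ℝ (Fin 3))) ∈
        parabolicCylinder (ρ / lam (σ k)) (0 : ℝ × (EuclideanSpace ℝ (Fin 3))) := by
    rintro k ⟨s, y⟩ hz
    have hbk : (2 : ℝ) ^ (k + 2) ≤ ρ / lam (σ k) :=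
      (pow_le_pow_right₀ (by norm_num) (by linarith [hσge k])).trans (hbig (σ k))
    rw [mem_parabolicCylinder] at hz ⊢
    simp only [Prod.fst_zero, Prod.snd_zero, zero_sub, dist_zero_right] at hz ⊢
    obtain ⟨⟨hs1, hs2⟩, hy⟩ := hz
    have h4 : (2 : ℝ) ^ (k + 2) = 2 * 2 ^ (k + 1) := by ring
    have h1 : (1 : ℝ) ≤ 2 ^ (k + 1) := one_le_pow₀ (by norm_num)
    refine ⟨⟨?_, by linarith⟩, ?_⟩
    · have h5 : ((2 : ℝ) ^ (k + 1)) ^ 2 + 1 < (ρ / lam (σ k)) ^ 2 := by nlinarith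
      linarith
    · linarith
  have hballw : ∀ m k : ℕ, m ≤ k → IsSuitableWeakSolutionInBall ((2 : ℝ) ^ m) 0 (w k) (qw k) := by
    intro m k hmk
    -- the shifted box lies in `Q(0, 2^(k+2))`, where `(v (σ k), qz (σ k))` is in the class
    have hboxsub : Icc ((((-1 : ℝ), (0 : EuclideanSpace ℝ (Fin 3))) : ℝ × (EuclideanSpace ℝ (Fin 3))).1 -
        ((2 : ℝ) ^ m) ^ 2) (((-1 : ℝ), (0 : EuclideanSpace ℝ (Fin 3))) : ℝ × (EuclideanSpace ℝ (Fin 3))).1 ×ˢ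
        closedBall (((-1 : ℝ), (0 : EuclideanSpace ℝ (Fin 3))) : ℝ × (EuclideanSpace ℝ (Fin 3))).2 ((2 : ℝ) ^ m) ⊆
        (parabolicCylinderOpens ((2 : ℝ) ^ (k + 2)) (0 : ℝ × (EuclideanSpace ℝ (Fin 3))) :
          Set (ℝ × (EuclideanSpace ℝ (Fin 3)))) := by
      rintro ⟨s, y⟩ ⟨hs, hy⟩
      simp only [mem_Icc] at hs
      rw [mem_closedBall, dist_zero_right] at hy
      show ((s, y) : ℝ × (EuclideanSpace ℝ (Fin 3))) ∈
        parabolicCylinder ((2 : ℝ) ^ (k + 2)) (0 : ℝ × (EuclideanSpace ℝ (Fin 3)))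
      rw [mem_parabolicCylinder]
      simp only [Prod.fst_zero, Prod.snd_zero, zero_sub, dist_zero_right]
      have h2 : (2 : ℝ) ^ m ≤ 2 ^ k := pow_le_pow_right₀ (by norm_num) hmk
      have h3 : (2 : ℝ) ^ (k + 2) = 4 * 2 ^ k := by ring
      have h1 : (1 : ℝ) ≤ 2 ^ k := one_le_pow₀ (by norm_num)
      refine ⟨⟨?_, by linarith [hs.2]⟩, ?_⟩
      · have : ((2 : ℝ) ^ m) ^ 2 ≤ (2 ^ k) ^ 2 := by gcongr
        nlinarith [hs.1]
      · calc ‖y‖ ≤ (2 : ℝ) ^ m := hy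
          _ < (2 : ℝ) ^ (k + 2) := by rw [h3]; nlinarith
    have hIn : IsSuitableWeakSolutionInBall ((2 : ℝ) ^ m) ((-1 : ℝ), (0 : EuclideanSpace ℝ (Fin 3)))
        (v (σ k)) (qz (σ k)) :=
      (hballs (k + 2) (σ k) (by linarith [hσge k])).1.isSuitableWeakSolutionInBall hboxsub
    have h1 := hIn.zoom (hcc_pos m)
    have h2 := h1.zoomOut (c := ((2 : ℝ) ^ m)⁻¹) (inv_pos.2 (hcc_pos m))
    rw [zoom_zoom, zoom_zoom, inv_mul_cancel₀ (hcc_pos m).ne', one_div, inv_inv,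
      show ((2 : ℝ) ^ m)⁻¹ ^ 2 * ((2 : ℝ) ^ m) ^ 2 = (1 : ℝ) ^ 2 by
        rw [← mul_pow, inv_mul_cancel₀ (hcc_pos m).ne']] at h2
    exact h2
  have hbdw : ∀ m k : ℕ, m ≤ k →
      typeIBound (parabolicCylinder ((2 : ℝ) ^ m) (0 : ℝ × (EuclideanSpace ℝ (Fin 3)))) (w k) (qw k) (Gw k) ≤ I := by
    intro m k hmk
    have h := typeIBound_nsZoom (c := (1 : ℝ)) one_pos (-1) (0 : EuclideanSpace ℝ (Fin 3))
      (parabolicCylinder ((2 : ℝ) ^ (k + 2)) (0 : ℝ × (EuclideanSpace ℝ (Fin 3)))) (v (σ k)) (qz (σ k)) (Gz (σ k))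
    have hsubpre : parabolicCylinder ((2 : ℝ) ^ m) (0 : ℝ × (EuclideanSpace ℝ (Fin 3))) ⊆
        stAffine ((1 : ℝ) ^ 2) 1 (-1) (0 : EuclideanSpace ℝ (Fin 3)) ⁻¹'
          parabolicCylinder ((2 : ℝ) ^ (k + 2)) (0 : ℝ × (EuclideanSpace ℝ (Fin 3))) := by
      rintro ⟨s, y⟩ hsy
      rw [mem_preimage, stAffine_apply, one_pow, one_mul, one_smul, zero_add]
      rw [mem_parabolicCylinder] at hsy ⊢
      simp only [Prod.fst_zero, Prod.snd_zero, zero_sub, dist_zero_right] at hsy ⊢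
      obtain ⟨⟨hs1, hs2⟩, hy⟩ := hsy
      have h2 : (2 : ℝ) ^ m ≤ 2 ^ k := pow_le_pow_right₀ (by norm_num) hmk
      have h3 : (2 : ℝ) ^ (k + 2) = 4 * 2 ^ k := by ring
      have h1 : (1 : ℝ) ≤ 2 ^ k := one_le_pow₀ (by norm_num)
      refine ⟨⟨?_, by linarith⟩, ?_⟩
      · have : ((2 : ℝ) ^ m) ^ 2 ≤ (2 ^ k) ^ 2 := by gcongr
        nlinarith
      · calc ‖y‖ < (2 : ℝ) ^ m := hy
          _ ≤ (2 : ℝ) ^ (k + 2) := by rw [h3]; nlinarith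
    calc typeIBound (parabolicCylinder ((2 : ℝ) ^ m) (0 : ℝ × (EuclideanSpace ℝ (Fin 3)))) (w k) (qw k) (Gw k)
        ≤ typeIBound (stAffine ((1 : ℝ) ^ 2) 1 (-1) (0 : EuclideanSpace ℝ (Fin 3)) ⁻¹'
            parabolicCylinder ((2 : ℝ) ^ (k + 2)) (0 : ℝ × (EuclideanSpace ℝ (Fin 3)))) (w k) (qw k) (Gw k) :=
          typeIBound_mono hsubpre
      _ = typeIBound (parabolicCylinder ((2 : ℝ) ^ (k + 2)) (0 : ℝ × (EuclideanSpace ℝ (Fin 3))))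
            (v (σ k)) (qz (σ k)) (Gz (σ k)) := h
      _ ≤ I := hIs (k + 2) (σ k) (by linarith [hσge k])
  have hMw : ∀ k, ∀ᵐ z ∂(volume.restrict (parabolicCylinder ((2 : ℝ) ^ k) (0 : ℝ × (EuclideanSpace ℝ (Fin 3))))),
      ‖w k z.1 z.2‖ ≤ M := by
    intro k
    filter_upwards [ae_restrict_mem (isOpen_parabolicCylinder _ _).measurableSet] with z hz
    rw [hw_apply]
    have hz' : z ∈ parabolicCylinder ((2 : ℝ) ^ (k + 1)) (0 : ℝ × (EuclideanSpace ℝ (Fin 3))) :=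
      parabolicCylinder_mono (hcc_pos k).le (pow_le_pow_right₀ (by norm_num) (Nat.le_succ k)) _ hz
    have hz0 : z.1 < 0 := by
      rw [mem_parabolicCylinder] at hz
      simpa using hz.1.2
    have h := hratev (σ k) _ (hshift_mem k z hz')
    refine h.trans (div_le_self hM ?_)
    show (1 : ℝ) ≤ Real.sqrt (-(z.1 - 1))
    refine (Real.le_sqrt zero_le_one (by linarith)).2 ?_
    rw [one_pow]
    linarith
  -- the limit candidate: the shifted representative
  set Ush : ℝ → (EuclideanSpace ℝ (Fin 3)) → (EuclideanSpace ℝ (Fin 3)) :=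
    (1 : ℝ) • stPull ((1 : ℝ) ^ 2) 1 (-1) 0 U with hUshdef
  have hUsh_apply : ∀ s y, Ush s y = U (s - 1) y := fun s y => by
    show ((1 : ℝ) • stPull ((1 : ℝ) ^ 2) 1 (-1) 0 U) s y = _
    rw [smul_stPull_apply, one_smul, one_pow, one_mul, one_smul, zero_add, neg_add_eq_sub]
  have hUsh_cont : ContinuousOn (uncurry Ush) (Iio 0 ×ˢ univ) := by
    have e : uncurry Ush = uncurry U ∘ fun q : ℝ × (EuclideanSpace ℝ (Fin 3)) => (q.1 - 1, q.2) := by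
      funext q
      simp only [comp_apply, uncurry, hUsh_apply]
    rw [e]
    refine hUc.comp ((continuous_fst.sub continuous_const).prodMk continuous_snd).continuousOn ?_
    intro q hq
    rw [mem_prod, mem_Iio] at hq ⊢
    exact ⟨by linarith [hq.1], mem_univ _⟩
  have hQslab : ∀ r : ℝ, parabolicCylinder r (0 : ℝ × (EuclideanSpace ℝ (Fin 3))) ⊆ Iio 0 ×ˢ univ :=
    fun r => parabolicCylinder_origin_subset_slab r
  have hUm : ∀ r : ℝ, 0 < r → AEStronglyMeasurable (uncurry Ush)
      (volume.restrict (parabolicCylinder r (0 : ℝ × (EuclideanSpace ℝ (Fin 3))))) := fun r _ =>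
    (hUsh_cont.mono (hQslab r)).aestronglyMeasurable (isOpen_parabolicCylinder _ _).measurableSet
  -- strong `L³` convergence of the shifted zooms
  have hconvw : ∀ r : ℝ, 0 < r → Tendsto (fun k => eLpNorm (uncurry (w k) - uncurry Ush) 3
      (volume.restrict (parabolicCylinder r (0 : ℝ × (EuclideanSpace ℝ (Fin 3)))))) atTop (𝓝 0) := by
    intro r hr
    have hpreR : stAffine ((1 : ℝ) ^ 2) 1 (-1) (0 : EuclideanSpace ℝ (Fin 3)) ⁻¹'
        parabolicCylinder r ((-1 : ℝ), (0 : EuclideanSpace ℝ (Fin 3))) =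
          parabolicCylinder r (0 : ℝ × (EuclideanSpace ℝ (Fin 3))) := by
      have h := LocalTypeIScaling.stAffine_preimage_parabolicCylinder (c := (1 : ℝ)) one_pos (-1)
        (0 : EuclideanSpace ℝ (Fin 3)) r (0 : ℝ × (EuclideanSpace ℝ (Fin 3)))
      have e0 : stAffine ((1 : ℝ) ^ 2) 1 (-1) (0 : EuclideanSpace ℝ (Fin 3)) (0 : ℝ × (EuclideanSpace ℝ (Fin 3))) =
          ((-1 : ℝ), (0 : EuclideanSpace ℝ (Fin 3))) := by
        rw [show (0 : ℝ × (EuclideanSpace ℝ (Fin 3))) = ((0 : ℝ), (0 : EuclideanSpace ℝ (Fin 3))) from rfl,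
          stAffine_apply, mul_zero, add_zero, smul_zero, add_zero]
      rwa [one_mul, e0] at h
    have hsubR : parabolicCylinder r ((-1 : ℝ), (0 : EuclideanSpace ℝ (Fin 3))) ⊆
        parabolicCylinder (r + 1) (0 : ℝ × (EuclideanSpace ℝ (Fin 3))) := by
      rintro ⟨s, y⟩ h
      rw [mem_parabolicCylinder] at h ⊢
      simp only [Prod.fst_zero, Prod.snd_zero, zero_sub, dist_zero_right] at h ⊢
      obtain ⟨⟨hs1, hs2⟩, hy⟩ := h
      exact ⟨⟨by nlinarith, by linarith⟩, by linarith⟩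
    have e : ∀ k, eLpNorm (uncurry (w k) - uncurry Ush) 3
        (volume.restrict (parabolicCylinder r (0 : ℝ × (EuclideanSpace ℝ (Fin 3))))) =
        eLpNorm (uncurry (v (σ k)) - uncurry U) 3
          (volume.restrict (parabolicCylinder r ((-1 : ℝ), (0 : EuclideanSpace ℝ (Fin 3))))) := by
      intro k
      have h := eLpNorm_comp_stAffine_preimage (β := (1 : ℝ) ^ 2) (γ := (1 : ℝ)) (by positivity) one_pos (-1)
        (0 : EuclideanSpace ℝ (Fin 3)) (uncurry (v (σ k)) - uncurry U)
        (parabolicCylinder r ((-1 : ℝ), (0 : EuclideanSpace ℝ (Fin 3)))) (q := 3) (by norm_num) (by norm_num)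
      rw [hpreR] at h
      have hfun : uncurry (w k) - uncurry Ush =
          (uncurry (v (σ k)) - uncurry U) ∘ stAffine ((1 : ℝ) ^ 2) 1 (-1) (0 : EuclideanSpace ℝ (Fin 3)) := by
        funext z
        rcases z with ⟨s, y⟩
        simp only [Pi.sub_apply, comp_apply, uncurry_apply_pair, stAffine_apply, hw_apply, hUsh_apply,
          one_pow, one_mul, one_smul, zero_add, neg_add_eq_sub]
      rw [hfun, h]
      simp
    simp_rw [e]
    have hle : ∀ k, eLpNorm (uncurry (v (σ k)) - uncurry U) 3
        (volume.restrict (parabolicCylinder r ((-1 : ℝ), (0 : EuclideanSpace ℝ (Fin 3))))) ≤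
        eLpNorm (uncurry (v (σ k)) - uncurry Ut) 3
          (volume.restrict (parabolicCylinder (r + 1) (0 : ℝ × (EuclideanSpace ℝ (Fin 3))))) := by
      intro k
      calc eLpNorm (uncurry (v (σ k)) - uncurry U) 3
            (volume.restrict (parabolicCylinder r ((-1 : ℝ), (0 : EuclideanSpace ℝ (Fin 3)))))
          ≤ eLpNorm (uncurry (v (σ k)) - uncurry U) 3
            (volume.restrict (parabolicCylinder (r + 1) (0 : ℝ × (EuclideanSpace ℝ (Fin 3))))) :=
            eLpNorm_mono_measure _ (Measure.restrict_mono hsubR le_rfl)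
        _ = eLpNorm (uncurry (v (σ k)) - uncurry Ut) 3
            (volume.restrict (parabolicCylinder (r + 1) (0 : ℝ × (EuclideanSpace ℝ (Fin 3))))) := by
            refine eLpNorm_congr_ae ?_
            filter_upwards [ae_restrict_of_ae_restrict_of_subset (hQslab (r + 1)) haeU] with z hz
            simp only [Pi.sub_apply, hz]
    exact tendsto_of_tendsto_of_tendsto_of_le_of_le tendsto_const_nhds (hconvU (r + 1) (by linarith))
      (fun _ => bot_le) hle
  obtain ⟨ψ, V, W, hψ, hVae, hVc, -, hUW, hWc, -, hpt, -, hcurl⟩ :=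
    exists_subseq_curl_limit hI hballw hbdw hMw hUm hconvw
  -- ## Step 7: identification of the representatives with the zooms and with `U`
  have hWU : EqOn (uncurry Ush) (uncurry W) (Iio 0 ×ˢ univ) :=
    Measure.eqOn_open_of_ae_eq hUW (isOpen_Iio.prod isOpen_univ) hUsh_cont hWc
  have hwc : ∀ k, ContinuousOn (uncurry (w k))
      (parabolicCylinder ((2 : ℝ) ^ (k + 1)) (0 : ℝ × (EuclideanSpace ℝ (Fin 3)))) := by
    intro k
    have e : uncurry (w k) = uncurry (v (σ k)) ∘ fun q : ℝ × (EuclideanSpace ℝ (Fin 3)) => (q.1 - 1, q.2) := by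
      funext q
      simp only [comp_apply, uncurry, hw_apply]
    rw [e]
    exact (hvc (σ k)).comp ((continuous_fst.sub continuous_const).prodMk continuous_snd).continuousOn
      fun q hq => hshift_mem k q hq
  have hVw : ∀ j, EqOn (uncurry (w (ψ j))) (uncurry (V j))
      (parabolicCylinder ((2 : ℝ) ^ (ψ j)) (0 : ℝ × (EuclideanSpace ℝ (Fin 3)))) := fun j =>
    Measure.eqOn_open_of_ae_eq (hVae j) (isOpen_parabolicCylinder _ _)
      ((hwc (ψ j)).mono (parabolicCylinder_mono (hcc_pos _).le
        (pow_le_pow_right₀ (by norm_num) (Nat.le_succ _)) _)) (hVc j)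
  have hevQ : ∀ t < 0, ∀ x : EuclideanSpace ℝ (Fin 3), ∀ᶠ j in atTop,
      ((t, x) : ℝ × (EuclideanSpace ℝ (Fin 3))) ∈ parabolicCylinder ((2 : ℝ) ^ (ψ j)) (0 : ℝ × (EuclideanSpace ℝ (Fin 3))) := by
    intro t ht x
    obtain ⟨m, hm⟩ := exists_mem_parabolicCylinder_two_pow ht x
    filter_upwards [eventually_ge_atTop m] with j hj
    exact parabolicCylinder_mono (hcc_pos m).le (pow_le_pow_right₀ (by norm_num) (hj.trans (hψ.id_le j))) _ hm
  have hptw : ∀ t < 0, ∀ x, Tendsto (fun j => w (ψ j) t x) atTop (𝓝 (Ush t x)) := by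
    intro t ht x
    have e : Ush t x = W t x := hWU (mk_mem_prod (mem_Iio.2 ht) (mem_univ x))
    rw [e]
    refine (hpt t ht x).congr' ?_
    filter_upwards [hevQ t ht x] with j hj
    exact (hVw j hj).symm
  have hcurlw : ∀ t < 0, ∀ x, Tendsto (fun j => curl (w (ψ j) t) x) atTop (𝓝 (curl (Ush t) x)) := by
    intro t ht x
    have e : Ush t = W t := funext fun y => hWU (mk_mem_prod (mem_Iio.2 ht) (mem_univ y))
    rw [e]
    refine (hcurl t ht x).congr' ?_
    filter_upwards [hevQ t ht x] with j hj
    have hopen : IsOpen {y : EuclideanSpace ℝ (Fin 3) |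
        ((t, y) : ℝ × (EuclideanSpace ℝ (Fin 3))) ∈ parabolicCylinder ((2 : ℝ) ^ (ψ j)) (0 : ℝ × (EuclideanSpace ℝ (Fin 3)))} :=
      (isOpen_parabolicCylinder _ _).preimage (continuous_const.prodMk continuous_id)
    have hev : V j t =ᶠ[𝓝 x] w (ψ j) t := by
      filter_upwards [hopen.mem_nhds hj] with y hy
      exact (hVw j hy).symm
    rw [curl_eq_curlCLM, curl_eq_curlCLM, hev.fderiv_eq]
  -- ## conclusion: reindex to the unshifted times `s = t - 1 < -1`
  refine ⟨fun j => φ₀ (σ (ψ j)), hφ₀.comp (hσ.comp hψ), U, Pt, Ht, hTI, hswU', hwgU', hIU', hsingU',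
    fun s hs y => ?_, fun s hs y => ?_⟩
  · have h := hptw (s + 1) (by linarith) y
    rw [hUsh_apply, add_sub_cancel_right] at h
    refine h.congr fun j => ?_
    rw [hw_apply, add_sub_cancel_right]
    rfl
  · have h := hcurlw (s + 1) (by linarith) y
    have e1 : Ush (s + 1) = U s := funext fun y' => by rw [hUsh_apply, add_sub_cancel_right]
    rw [e1] at h
    refine h.congr fun j => ?_
    have e2 : w (ψ j) (s + 1) = v (σ (ψ j)) s := funext fun y' => by rw [hw_apply, add_sub_cancel_right]
    rw [e2]
    show curl ((lam (σ (ψ j)) • stPull (lam (σ (ψ j)) ^ 2) (lam (σ (ψ j))) z₀.1 z₀.2 u) s) y = _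
    rw [curl_smul_stPull, ← sq]

end Literature.Analysis.FluidPDE.LocalTypeIBlowup

end
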